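import Summits.BirchSwinnertonDyer.BirchSwinnertonDyer.Theses.PAdicOrderV2
import Literature.Barriers.BirchSwinnertonDyer.PAdicFunctionalEquationParityProofs
import Literature.NumberTheory.EllipticCurves.RootNumberModularityProofs
import Literature.NumberTheory.EllipticCurves.RootNumberParityProofs
import Literature.NumberTheory.EllipticCurves.AnalyticRankModularityProofs

/-!
# BirchSwinnertonDyer / PAdicOrderV2 — crux #2 `PAdicOrderComparisonR2`, line `Sketch`,
# stub S2: `ord_{T=0} L_p(E, T) ≡ ord_{s=1} L(E, s) (mod 2)` at ANY level and ANY good ordinary `p`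

Support file for `stmt-BirchSwinnertonDyer-0489`. For `W / ℚ` elliptic and globally minimal, `p` a
good ordinary prime (also `p = 2`) and `f ∈ S₂(Γ₀(N))` the newform of `W` at an ARBITRARY level `N`
(`IsNewformOf W f`), the `T`-order of the Mazur–Swinnerton-Dyer `p`-adic `L`-function
`L_p(E, T) = padicLFunction f (unitRoot W p)` and the analytic rank `r_an = ord_{s=1} L(E, s)` have
the same parity (Greenberg, LNM 1716, §5, p. 181: "The 'signs' in the functional equations for
`L_p(E/ℚ, s)` and `L(E/ℚ, s)` are the same" — both are `-ε(f)`, `ε(f)` the Atkin–Lehner eigenvalue).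

The tree proves this at the conductor level `N = N_W` and for `p ≠ 2`
(`Literature.Barriers.BirchSwinnertonDyer.even_order_padicLFunction_iff_even_analyticRank_conductorLevel`),
going through `W.rootNumber` (a level-`N_W` notion). Here the comparison is made level-free, never
mentioning `W.rootNumber` (so Carayol's level theorem is not needed):

* `p`-adic side (any level, any `p`): `L_p(E, T^ι) = σ (1 + T)^c L_p(E, T)` with `σ = -ε(f) = ±1`
  (`padicLFunction_mem_padicFEClass_neg_frickeEigenvalue`), and `L_p ≠ 0`
  (`padicLFunction_ne_zero_holds`), whence `σ = (-1)^{ord_T L_p}` in `ℚ_p`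
  (`eq_neg_one_pow_of_subst_eq`);
* complex side (any level): Hecke's functional equation `Λ_N(f, s) = i² ε(f) Λ_N(f, 2 - s)`
  (`IsNewform0.exists_functional_equation_holds`) for the entire continuation `Λ` of `Λ_N(f, s)`,
  which continues `N^{s/2}(2π)^{-s}Γ(s)L(W, s)` (`mem_completedLContinuations_of_isNewformOf`) and so
  vanishes at `s = 1` to order exactly `r_an` (level-`N` version of
  `analyticOrderAt_completedLContinuation_one`); `G(t) = Λ(1 + t)` satisfies `G(-t) = -ε(f) G(t)`,
  so `(-1)^{r_an} = -ε(f)` (`neg_one_pow_eq_of_comp_neg_eq_mul`);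
* combine: `σ ∈ {1, -1}` as an integer; `(-1)^{r_an} = σ` in `ℂ` and `(-1)^{ord} = σ` in `ℚ_p`,
  both of characteristic `0`.
-/

set_option linter.dupNamespace false

namespace Summit.BirchSwinnertonDyer.BirchSwinnertonDyer.Theorems

open scoped MatrixGroups ModularForm

open Filter Topology CongruenceSubgroup PowerSeries
  Literature.NumberTheory.EllipticCurves Literature.NumberTheory.EllipticCurves.ModularForms
  Literature.Barriers.BirchSwinnertonDyer

/-- **Order of vanishing at the centre, at any level.** For an elliptic `W / ℚ` with entire
`L`-function and `N ≠ 0`, an entire continuation `Λ` of the completed `L`-function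
`N^{s/2}(2π)^{-s}Γ(s)L(W, s)` (`Λ ∈ W.completedLContinuations N`) vanishes at `s = 1` to order
exactly `r_an = ord_{s=1} L(W, s)`: near `1`, `Λ = h_N · L` (`completedLContinuation_eqOn_of_re_pos`)
with `h_N` holomorphic and `h_N(1) ≠ 0`. Level-`N` copy of
`WeierstrassCurve.analyticOrderAt_completedLContinuation_one` (Silverman, *AEC* C.16, Thm. C.16.3
and the sentence following it). [cite: SilvermanAEC2009, App. C §16 (Thm. C.16.3, p. 451)] -/
theorem s2_analyticOrderAt_completedLContinuation_one_level (W : WeierstrassCurve ℚ) [W.IsElliptic]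
    (hE : W.HasEntireLFunction) {N : ℕ} (hN : N ≠ 0) {Λ : ℂ → ℂ}
    (hΛ : Λ ∈ W.completedLContinuations N) : analyticOrderAt Λ 1 = W.analyticRank := by
  have hUo : IsOpen {s : ℂ | 0 < s.re} := isOpen_lt continuous_const Complex.continuous_re
  have h1 : (1 : ℂ) ∈ {s : ℂ | 0 < s.re} := by simp
  set h : ℂ → ℂ := fun s ↦
    (N : ℂ) ^ (s / 2) * (2 * Real.pi : ℂ) ^ (-s) * Complex.Gamma s with hdef
  -- `Λ = h · L` near `1`
  have hev : Λ =ᶠ[𝓝 1] fun s ↦ h s * W.entireLFunction s := by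
    filter_upwards [hUo.mem_nhds h1] with s hs
    exact W.completedLContinuation_eqOn_of_re_pos hE hN hΛ hs
  rw [analyticOrderAt_congr hev, W.analyticRank_eq_analyticOrderAt hE]
  have hh : AnalyticAt ℂ h 1 :=
    (DifferentiableOn.analyticAt (s := {s : ℂ | 0 < s.re})
      (fun s hs ↦ (WeierstrassCurve.differentiableAt_archFactor hN hs).differentiableWithinAt)
      (hUo.mem_nhds h1))
  have hL : AnalyticAt ℂ W.entireLFunction 1 := (W.differentiable_entireLFunction hE).analyticAt 1
  have hh0 : analyticOrderAt h 1 = 0 :=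
    hh.analyticOrderAt_eq_zero.mpr (WeierstrassCurve.archFactor_ne_zero hN (by simp))
  have := analyticOrderAt_mul hh hL
  rw [hh0, zero_add] at this
  exact this

/-- **The complex sign at any level: `(-1)^{r_an} = -ε(f)`.** If `f ∈ S₂(Γ₀(N))` is the newform of
the elliptic `W / ℚ` (any level `N`), then `(-1)^{ord_{s=1} L(W, s)} = -ε(f)` in `ℂ`,
`ε(f) = frickeEigenvalue f`: `L(W, s)` is entire (`hasEntireLFunction_of_cuspCoeff_eq`), Hecke's
functional equation `Λ_N(f, s) = i² ε(f) Λ_N(f, 2 - s)` (`IsNewform0.exists_functional_equation_holds`,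
Diamond–Shurman Thm. 5.10.2) holds for the entire continuation `Λ` of `Λ_N(f, s)`, which continues
`Λ_N(W, s)` (`mem_completedLContinuations_of_isNewformOf`) and so has order `r_an` at `s = 1`;
then `G(t) = Λ(1 + t)` satisfies `G(-t) = -ε(f) G(t)` and `neg_one_pow_eq_of_comp_neg_eq_mul`
applies (Silverman, *AEC* C.16, p. 451: the parity of the sign "determines whether the order of
vanishing … is odd or even"). [cite: SilvermanAEC2009, App. C §16 (Thm. C.16.3, p. 451)] -/
theorem s2_neg_one_pow_analyticRank_eq_neg_frickeEigenvalue (W : WeierstrassCurve ℚ) [W.IsElliptic]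
    {N : ℕ} [NeZero N] {f : CuspForm (Gamma0 N) 2} (hf : IsNewformOf W f) :
    (-1 : ℂ) ^ W.analyticRank = -frickeEigenvalue f := by
  have hN : N ≠ 0 := NeZero.ne N
  have hE : W.HasEntireLFunction :=
    WeierstrassCurve.hasEntireLFunction_of_cuspCoeff_eq (strictWidthInfty_Gamma0 N) W f hf.2
  obtain ⟨Λ, hΛ, hfe⟩ :=
    IsNewform0.exists_functional_equation_holds (N := N) (k := (2 : ℤ)) hf.1
  have hmem : Λ ∈ W.completedLContinuations N :=
    W.mem_completedLContinuations_of_isNewformOf hE hf hΛ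
  -- Hecke: `Λ (2 - s) = -ε Λ s`
  have hI : Complex.I ^ (2 : ℤ) = -1 := by rw [zpow_two, Complex.I_mul_I]
  have hback : ∀ s : ℂ, Λ (2 - s) = -frickeEigenvalue f * Λ s := by
    intro s
    have h := hfe (2 - s)
    have h2 : ((2 : ℤ) : ℂ) - (2 - s) = s := by push_cast; ring
    rw [hI, h2] at h
    rw [h]; ring
  -- `G(t) = Λ(1 + t)`, analytic at `0`, order `r_an`, `G(-t) = -ε G(t)`
  set G : ℂ → ℂ := fun t ↦ Λ (1 + t) with hGdef
  have hGan : AnalyticAt ℂ G 0 := by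
    have hΛ1 : AnalyticAt ℂ Λ (1 + 0) := hmem.1.analyticAt _
    exact hΛ1.comp_of_eq (analyticAt_const.add analyticAt_id) rfl
  have hGord : analyticOrderAt G 0 = W.analyticRank := by
    have hg : AnalyticAt ℂ (fun t : ℂ ↦ 1 + t) 0 := analyticAt_const.add analyticAt_id
    have hg' : deriv (fun t : ℂ ↦ 1 + t) 0 ≠ 0 := by
      rw [deriv_const_add, deriv_id'']
      exact one_ne_zero
    have := analyticOrderAt_comp_of_deriv_ne_zero (f := Λ) hg hg'
    simp only [Function.comp_def, add_zero] at this
    rw [hGdef, this]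
    exact s2_analyticOrderAt_completedLContinuation_one_level W hE hN hmem
  have hGfe : ∀ t : ℂ, G (-t) = -frickeEigenvalue f * G t := by
    intro t
    simp only [hGdef]
    rw [← hback (1 + t)]
    congr 1
    ring
  exact neg_one_pow_eq_of_comp_neg_eq_mul hGan hGord hGfe

/-- **The `p`-adic sign at any level and any `p`: `-ε(f) = (-1)^{ord_T L_p}`.** For `W / ℚ`
elliptic and globally minimal, good ordinary at `p` (also `p = 2`), and `f ∈ S₂(Γ₀(N))` its
newform (any level), there is `σ = ±1 ∈ ℤ` with `σ = -ε(f)` in `ℂ` and `σ = (-1)^{ord_{T=0} L_p(E,T)}`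
in `ℚ_p`: the functional equation `L_p(E, T^ι) = σ (1 + T)^c L_p(E, T)`
(`padicLFunction_mem_padicFEClass_neg_frickeEigenvalue`, Mazur–Tate–Teitelbaum §I.17), `L_p ≠ 0`
(`padicLFunction_ne_zero_holds`), and comparison of the coefficients of `T^{ord}`
(`eq_neg_one_pow_of_subst_eq`; Greenberg, LNM 1716, §5, p. 181).
[cite: GreenbergLNM1716, §5 (p. 181) and §1 (pp. 67–68)] -/
theorem s2_exists_sign_eq_neg_one_pow_order_padicLFunction (W : WeierstrassCurve ℚ) [W.IsElliptic]
    [W.IsGloballyMinimal] (p : ℕ) [Fact p.Prime] (hord : IsOrdinaryAt W p) {N : ℕ} [NeZero N]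
    {f : CuspForm (Gamma0 N) 2} (hf : IsNewformOf W f) :
    ∃ σ : ℤ, (σ = 1 ∨ σ = -1) ∧ (σ : ℂ) = -frickeEigenvalue f ∧
      ((σ : ℤ) : ℚ_[p]) = (-1) ^ (padicLFunction f (unitRoot W p : ℚ_[p])).order.toNat := by
  obtain ⟨σ, hσ, hσC, u, hu, hFE'⟩ := padicLFunction_mem_padicFEClass_neg_frickeEigenvalue hord hf
  have h0 : padicLFunction f (unitRoot W p : ℚ_[p]) ≠ 0 :=
    padicLFunction_ne_zero_holds (W := W) (p := p) (f := f) hord hf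
  exact ⟨σ, hσ, hσC, eq_neg_one_pow_of_subst_eq constantCoeff_invOnePlusSubOne
    coeff_one_invOnePlusSubOne (binomialMultipliers_subset_principalUnits p hu) hFE'
    (coe_toNat_order h0).symm⟩

/-- **Stub S2 of line `Sketch` (crux #2 `PAdicOrderComparisonR2`): `ord_{T=0} L_p(E, T) ≡
ord_{s=1} L(E, s) (mod 2)` at every good ordinary prime `p` (also `p = 2`) and for the newform of
`E` at ANY level.** "The 'signs' in the functional equations for `L_p(E/ℚ, s)` and `L(E/ℚ, s)` are
the same" (Greenberg, LNM 1716, §5, p. 181): both equal `-ε(f)`; the `p`-adic one is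
`(-1)^{ord_T L_p}` (`s2_exists_sign_eq_neg_one_pow_order_padicLFunction`), the complex one is
`(-1)^{r_an}` (`s2_neg_one_pow_analyticRank_eq_neg_frickeEigenvalue`), and `ℚ_p`, `ℂ` have
characteristic `0`. (Convention `(⊤ : ℕ∞).toNat = 0` is vacuous: `L_p ≠ 0`.)
[cite: GreenbergLNM1716, §5 (p. 181)] -/
theorem stub_even_order_iff_even_analyticRank : ∀ (W : WeierstrassCurve ℚ) [W.IsElliptic] [W.IsGloballyMinimal] (p : ℕ) [Fact p.Prime], Literature.NumberTheory.EllipticCurves.IsOrdinaryAt W p → ∀ {N : ℕ} [NeZero N] (f : CuspForm (CongruenceSubgroup.Gamma0 N) 2), Literature.NumberTheory.EllipticCurves.ModularForms.IsNewformOf W f → (Even (Literature.NumberTheory.EllipticCurves.padicLFunction f (Literature.NumberTheory.EllipticCurves.unitRoot W p : ℚ_[p])).order.toNat ↔ Even W.analyticRank) := by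
  intro W _ _ p _ hord N _ f hf
  obtain ⟨σ, hσ, hσC, hσp⟩ := s2_exists_sign_eq_neg_one_pow_order_padicLFunction W p hord hf
  have hC : (-1 : ℂ) ^ W.analyticRank = (σ : ℂ) := by
    rw [hσC]; exact s2_neg_one_pow_analyticRank_eq_neg_frickeEigenvalue W hf
  have hnegp : (-1 : ℚ_[p]) ≠ 1 := by norm_num
  have hnegC : (-1 : ℂ) ≠ 1 := by norm_num
  rcases hσ with rfl | rfl
  · -- `σ = 1`: both orders are even
    refine iff_of_true ((neg_one_pow_eq_one_iff_even hnegp).mp ?_)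
      ((neg_one_pow_eq_one_iff_even hnegC).mp ?_)
    · rw [← hσp, Int.cast_one]
    · rw [hC, Int.cast_one]
  · -- `σ = -1`: both orders are odd
    refine iff_of_false ?_ ?_
    · rw [Nat.not_even_iff_odd, ← neg_one_pow_eq_neg_one_iff_odd hnegp, ← hσp, Int.cast_neg,
        Int.cast_one]
    · rw [Nat.not_even_iff_odd, ← neg_one_pow_eq_neg_one_iff_odd hnegC, hC, Int.cast_neg,
        Int.cast_one]

end Summit.BirchSwinnertonDyer.BirchSwinnertonDyer.Theorems
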